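import Summits.ValiantsHypothesis.ValiantsHypothesis.Theorems.GrenetZeonDualUnipotentThreeHalvesHeavyTopLevelOne
import Summits.ValiantsHypothesis.ValiantsHypothesis.Theorems.GrenetZeonDualUnipotentThreeHalvesHeavyTopTorusInitial
import Summits.ValiantsHypothesis.ValiantsHypothesis.Theorems.GrenetZeonDualUnipotentThreeHalvesHeavyTopBorderEnvelope

/-!
# `GrenetZeon.DualUnipotentThreeHalves` (stmt-ValiantsHypothesis-24318), R2 heavy-top instrument — P-Q1 LEVEL 1 FOR A SUBSPACE:
# the border-graded limit of a nilpotent space `V ∋ J_s ⊕ 0` with `Z^s = 0` on `V` and `dim V = C(s+1,2) − 1` is one of the spaces `W⁽ᶜ⁾`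

Experiment cell «val-heavytop-census» (D-0160), engine seat val-htc-eng-2 g3 (kernel-only lane; P-Q1 port, eng lineage, R336 (5) / R340 (3)).
Q1-PROOF §0–§1 for an actual space: ★ `level_one_of_subspace` — for `s ≥ 3`, `A = J_s ⊕ 0` on `Fin (s+1)`, and a linear space `V ≤ M_{s+1}(ℂ)`
with `Z^s = 0` for all `Z ∈ V` (generic type `(s,1)` after the MacDonald–MacDougall–Sweet reduction — taken as hypothesis), `A ∈ V` and
`finrank V = C(s+1,2) − 1`, the graded limit `W = in_μ(V)` along the border torus (✓ `HeavyTopTorusInitial.exists_torus_initial_subspace` with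
row weights `ρ = (1,…,1,0)`: degree `+1` = column `ω`, `−1` = row `ω`, `0` = block) satisfies ALL the conclusions of ✓ `…TorusInitial` AND
`W = W⁽ᶜ⁾` for some `c ≤ s − 1` (✓ `HeavyTopLevelOne.level_one`), via the envelope ✓ `HeavyTopBorderEnvelope.envelope_of_mem` (which is graded,
so it contains `W`) and `tr = 0` on `W` (the corner entry vanishes).  This is the input of Level 2 (lead-g2 `P-Q1-LEVEL2-PORTMAP.md`, L2.0: the
chart over `W⁽ᶜ⁾` with unique lifts in `V`).

Honest framing: a step of the instrument's kernel port P-Q1; nothing here proves or refutes `HeavyTopLaw`/`HeavyTopSlowLaw`, 24318, S3 or 8062;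
`VP ≠ VNP` is NOT proved.  No definitions.  [Q1-PROOF §0–§1 (val-htc-lead g2); this seat]
-/

noncomputable section

-- single-conjunct layout: Sub = Summit, duplicated namespace component intended
set_option linter.dupNamespace false

namespace Summit.ValiantsHypothesis.ValiantsHypothesis.Theorems.GrenetZeon.HeavyTopLevelOneSubspace

open Matrix
open Summit.ValiantsHypothesis.ValiantsHypothesis.Theorems.GrenetZeon.HeavyTopLevelOne (level_one)
open Summit.ValiantsHypothesis.ValiantsHypothesis.Theorems.GrenetZeon.HeavyTopTorusInitial (exists_torus_initial_subspace)
open Summit.ValiantsHypothesis.ValiantsHypothesis.Theorems.GrenetZeon.HeavyTopBorderEnvelope (envelope_of_mem)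

/-- ★ **Q1-PROOF Level 1 for a codimension-one space of type `(s,1)`.**  See the module docstring.  The degree projections are written with the
border row weights `ρ a = if a = ω then 0 else 1` exactly as produced by ✓ `exists_torus_initial_subspace`. [Q1-PROOF §0–§1] -/
theorem level_one_of_subspace {s : ℕ} (hs : 3 ≤ s) (A : Matrix (Fin (s + 1)) (Fin (s + 1)) ℂ)
    (hA : ∀ i j : Fin (s + 1), A i j = if (j : ℕ) = i + 1 ∧ (j : ℕ) < s then 1 else 0)
    (V : Submodule ℂ (Matrix (Fin (s + 1)) (Fin (s + 1)) ℂ)) (hV : ∀ Z ∈ V, Z ^ s = 0) (hAV : A ∈ V)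
    (hdimV : Module.finrank ℂ V = (s + 1).choose 2 - 1) :
    ∃ W : Submodule ℂ (Matrix (Fin (s + 1)) (Fin (s + 1)) ℂ),
      Module.finrank ℂ W = Module.finrank ℂ V ∧
      (∀ Z ∈ W, ∀ d : ℤ, (Matrix.of fun a b : Fin (s + 1) =>
        if ((fun x : Fin (s + 1) => if x = Fin.last s then (0 : ℕ) else 1) a : ℤ) -
            (fun x : Fin (s + 1) => if x = Fin.last s then (0 : ℕ) else 1) b = d then Z a b else 0) ∈ W) ∧
      (∀ Z ∈ V, ∀ d : ℤ, (∀ a b : Fin (s + 1),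
          ((fun x : Fin (s + 1) => if x = Fin.last s then (0 : ℕ) else 1) a : ℤ) -
            (fun x : Fin (s + 1) => if x = Fin.last s then (0 : ℕ) else 1) b < d → Z a b = 0) →
        (Matrix.of fun a b : Fin (s + 1) =>
          if ((fun x : Fin (s + 1) => if x = Fin.last s then (0 : ℕ) else 1) a : ℤ) -
              (fun x : Fin (s + 1) => if x = Fin.last s then (0 : ℕ) else 1) b = d then Z a b else 0) ∈ W) ∧
      (∀ Z ∈ W, Z ^ s = 0) ∧ A ∈ W ∧
      ∃ c : ℕ, c ≤ s - 1 ∧ ∀ Z : Matrix (Fin (s + 1)) (Fin (s + 1)) ℂ, Z ∈ W ↔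
        ∀ a b : Fin (s + 1), Z a b ≠ 0 →
          (a.val < b.val ∧ b ≠ Fin.last s) ∨ (b = Fin.last s ∧ a.val < c) ∨ (a = Fin.last s ∧ c < b.val ∧ b ≠ Fin.last s) := by
  classical
  have hs1 : 1 ≤ s := by omega
  set ω : Fin (s + 1) := Fin.last s with hωdef
  have hωv : ω.val = s := by simp [hωdef]
  set ρ : Fin (s + 1) → ℕ := fun x => if x = ω then 0 else 1 with hρ
  obtain ⟨W, hfin, hgr, hinit, henv, hpowW⟩ := exists_torus_initial_subspace ρ V
  -- degrees of the positions
  have hdeg : ∀ a b : Fin (s + 1), ((ρ a : ℤ) - ρ b = 1 ↔ (a ≠ ω ∧ b = ω)) ∧ ((ρ a : ℤ) - ρ b = -1 ↔ (a = ω ∧ b ≠ ω)) ∧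
      ((ρ a : ℤ) - ρ b = 0 ↔ (a = ω ↔ b = ω)) ∧ (-1 ≤ (ρ a : ℤ) - ρ b) := by
    intro a b
    by_cases ha : a = ω <;> by_cases hb : b = ω <;> simp [hρ, ha, hb]
  have hpow : ∀ Z ∈ W, Z ^ s = 0 := hpowW s hV
  -- the three projections
  have hcolP : ∀ Z ∈ W, (Matrix.of fun a b : Fin (s + 1) => if a ≠ ω ∧ b = ω then Z a b else 0) ∈ W := by
    intro Z hZ
    have h := hgr Z hZ 1
    have e : (Matrix.of fun a b : Fin (s + 1) => if (ρ a : ℤ) - ρ b = 1 then Z a b else 0) =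
        Matrix.of fun a b : Fin (s + 1) => if a ≠ ω ∧ b = ω then Z a b else 0 := by
      ext a b; simp only [Matrix.of_apply, (hdeg a b).1]
    rw [e] at h; exact h
  have hrowP : ∀ Z ∈ W, (Matrix.of fun a b : Fin (s + 1) => if a = ω ∧ b ≠ ω then Z a b else 0) ∈ W := by
    intro Z hZ
    have h := hgr Z hZ (-1)
    have e : (Matrix.of fun a b : Fin (s + 1) => if (ρ a : ℤ) - ρ b = -1 then Z a b else 0) =
        Matrix.of fun a b : Fin (s + 1) => if a = ω ∧ b ≠ ω then Z a b else 0 := by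
      ext a b; simp only [Matrix.of_apply, (hdeg a b).2.1]
    rw [e] at h; exact h
  -- the envelope `T` is graded and contains `V`, hence `W`
  let P : Matrix (Fin (s + 1)) (Fin (s + 1)) ℂ → Prop := fun B => B ω 0 = 0 ∧ B ⟨s - 1, by omega⟩ ω = 0 ∧
    ∀ h : ℕ, h < s → ∑ x : Fin s, (if h ≤ x.val then B (Fin.castSucc x) ⟨x.val - h, by omega⟩ else 0) = 0
  have hP : ∀ B, P B ↔ (B ω 0 = 0 ∧ B ⟨s - 1, by omega⟩ ω = 0 ∧
      ∀ h : ℕ, h < s → ∑ x : Fin s, (if h ≤ x.val then B (Fin.castSucc x) ⟨x.val - h, by omega⟩ else 0) = 0) := fun B => Iff.rfl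
  have hP0 : P 0 := ⟨rfl, rfl, fun h _ => Finset.sum_eq_zero fun x _ => by simp⟩
  have hPadd : ∀ B B', P B → P B' → P (B + B') := by
    rintro B B' ⟨h0, h1, hσ⟩ ⟨h0', h1', hσ'⟩
    refine ⟨by simp [h0, h0'], by simp [h1, h1'], fun h hh => ?_⟩
    have e : ∀ x : Fin s, (if h ≤ x.val then (B + B') (Fin.castSucc x) ⟨x.val - h, by omega⟩ else 0) =
        (if h ≤ x.val then B (Fin.castSucc x) ⟨x.val - h, by omega⟩ else 0) +
          (if h ≤ x.val then B' (Fin.castSucc x) ⟨x.val - h, by omega⟩ else 0) := by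
      intro x; split_ifs <;> simp
    simp only [e, Finset.sum_add_distrib, hσ h hh, hσ' h hh, add_zero]
  have hPsmul : ∀ (c : ℂ) B, P B → P (c • B) := by
    rintro c B ⟨h0, h1, hσ⟩
    refine ⟨by simp [h0], by simp [h1], fun h hh => ?_⟩
    have e : ∀ x : Fin s, (if h ≤ x.val then (c • B) (Fin.castSucc x) ⟨x.val - h, by omega⟩ else 0) =
        c * (if h ≤ x.val then B (Fin.castSucc x) ⟨x.val - h, by omega⟩ else 0) := by
      intro x; split_ifs <;> simp
    simp only [e, ← Finset.mul_sum, hσ h hh, mul_zero]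
  obtain ⟨T, hT⟩ : ∃ T : Submodule ℂ (Matrix (Fin (s + 1)) (Fin (s + 1)) ℂ), ∀ B, B ∈ T ↔
      (B ω 0 = 0 ∧ B ⟨s - 1, by omega⟩ ω = 0 ∧
        ∀ h : ℕ, h < s → ∑ x : Fin s, (if h ≤ x.val then B (Fin.castSucc x) ⟨x.val - h, by omega⟩ else 0) = 0) :=
    ⟨{ carrier := {B | P B}
       zero_mem' := hP0
       add_mem' := fun hB hB' => hPadd _ _ hB hB'
       smul_mem' := fun c B hB => hPsmul c B hB }, fun B => hP B⟩
  have hVT : V ≤ T := fun B hB => (hT B).2 (envelope_of_mem hs1 V hV A hA hAV B hB)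
  have hTgr : ∀ B ∈ T, ∀ d : ℤ, (Matrix.of fun a b : Fin (s + 1) => if (ρ a : ℤ) - ρ b = d then B a b else 0) ∈ T := by
    intro B hB d
    obtain ⟨h0, h1, hσ⟩ := (hT B).1 hB
    refine (hT _).2 ⟨?_, ?_, fun h hh => ?_⟩
    · simp only [Matrix.of_apply]; split_ifs <;> simp [h0]
    · simp only [Matrix.of_apply]; split_ifs <;> simp [h1]
    · have hdeg0 : ∀ x : Fin s, h ≤ x.val → ((ρ (Fin.castSucc x) : ℤ) - ρ ⟨x.val - h, by omega⟩ = 0) := by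
        intro x hx
        have h3 := (hdeg (Fin.castSucc x) ⟨x.val - h, by omega⟩).2.2.1
        rw [h3]
        constructor
        · intro e; exact absurd e (Fin.castSucc_ne_last x)
        · intro e; rw [Fin.ext_iff, hωv] at e; simp at e; omega
      by_cases hd : d = 0
      · subst hd
        have e : ∀ x : Fin s, (if h ≤ x.val then (Matrix.of fun a b : Fin (s + 1) => if (ρ a : ℤ) - ρ b = 0 then B a b else 0)
            (Fin.castSucc x) ⟨x.val - h, by omega⟩ else 0) = (if h ≤ x.val then B (Fin.castSucc x) ⟨x.val - h, by omega⟩ else 0) := by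
          intro x
          by_cases hx : h ≤ x.val
          · rw [if_pos hx, if_pos hx, Matrix.of_apply, if_pos (hdeg0 x hx)]
          · rw [if_neg hx, if_neg hx]
        simp only [e]; exact hσ h hh
      · refine Finset.sum_eq_zero fun x _ => ?_
        by_cases hx : h ≤ x.val
        · rw [if_pos hx, Matrix.of_apply, if_neg (by rw [hdeg0 x hx]; exact fun e => hd e.symm)]
        · rw [if_neg hx]
  have hWT : W ≤ T := henv T hVT hTgr
  have hT0 : ∀ Z ∈ W, Z ω 0 = 0 := fun Z hZ => ((hT Z).1 (hWT hZ)).1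
  have hT1 : ∀ Z ∈ W, Z ⟨s - 1, by omega⟩ ω = 0 := fun Z hZ => ((hT Z).1 (hWT hZ)).2.1
  -- the corner entry vanishes: `tr Z = 0` and the block trace `σ_0(Z) = 0`
  have hTω : ∀ Z ∈ W, Z ω ω = 0 := by
    intro Z hZ
    have hσ0 := ((hT Z).1 (hWT hZ)).2.2 0 (by omega)
    have htr : Matrix.trace Z = 0 := (Matrix.isNilpotent_trace_of_isNilpotent ⟨s, hpow Z hZ⟩).eq_zero
    rw [Matrix.trace, Fin.sum_univ_castSucc] at htr
    have e : ∀ x : Fin s, (if 0 ≤ x.val then Z (Fin.castSucc x) ⟨x.val - 0, by omega⟩ else 0) = Z (Fin.castSucc x) (Fin.castSucc x) := by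
      intro x
      rw [if_pos (Nat.zero_le _)]
      congr 1
    simp only [e, Matrix.diag_apply] at hσ0 htr
    rw [hσ0, zero_add] at htr
    exact htr
  have hblkP : ∀ Z ∈ W, (Matrix.of fun a b : Fin (s + 1) => if a ≠ ω ∧ b ≠ ω then Z a b else 0) ∈ W := by
    intro Z hZ
    have h := hgr Z hZ 0
    have e : (Matrix.of fun a b : Fin (s + 1) => if (ρ a : ℤ) - ρ b = 0 then Z a b else 0) =
        Matrix.of fun a b : Fin (s + 1) => if a ≠ ω ∧ b ≠ ω then Z a b else 0 := by
      ext a b; simp only [Matrix.of_apply, (hdeg a b).2.2.1]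
      by_cases ha : a = ω <;> by_cases hb : b = ω
      · subst ha; subst hb; simp [hTω Z hZ]
      · simp [ha, hb]
      · simp [ha, hb]
      · simp [ha, hb]
    rw [e] at h; exact h
  -- `A ∈ W`: it is homogeneous of degree 0 and lies in `V`
  have hArow : ∀ j, A ω j = 0 := fun j => by rw [hA]; exact if_neg (by rw [hωv]; omega)
  have hAcol : ∀ i, A i ω = 0 := fun i => by rw [hA]; exact if_neg (by rw [hωv]; omega)
  have hAW : A ∈ W := by
    have h := hinit A hAV 0 (fun a b hab => by
      have hlt : (ρ a : ℤ) - ρ b = -1 := by have := (hdeg a b).2.2.2; omega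
      rw [(hdeg a b).2.1] at hlt
      rw [hlt.1]; exact hArow b)
    have e : (Matrix.of fun a b : Fin (s + 1) => if (ρ a : ℤ) - ρ b = 0 then A a b else 0) = A := by
      ext a b; simp only [Matrix.of_apply, (hdeg a b).2.2.1]
      by_cases ha : a = ω <;> by_cases hb : b = ω
      · simp [ha, hb]
      · rw [if_neg (by tauto), ha, hArow]
      · rw [if_neg (by tauto), hb, hAcol]
      · simp [ha, hb]
    rw [e] at h; exact h
  have hdim : Module.finrank ℂ W = (s + 1).choose 2 - 1 := hfin.trans hdimV
  obtain ⟨c, hc, hshape⟩ := level_one hs A hA W hcolP hrowP hblkP hpow hAW hT0 hT1 hTω hdim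
  exact ⟨W, hfin, hgr, hinit, hpow, hAW, c, hc, hshape⟩

end Summit.ValiantsHypothesis.ValiantsHypothesis.Theorems.GrenetZeon.HeavyTopLevelOneSubspace

end
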